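import Literature.AlgebraicGeometry.HodgeTheory.ComplexTorusRationalHodgeStructureComparison
import Literature.Geometry.Kaehler.ComplexTorusRationalHodgeStructurePullback
import Literature.AlgebraicGeometry.Motives.HodgeStructureAbelianTypeTensorPower
import HarnessLib

/-!
# The Hodge structures `Hᵏ(X, ℚ)` of an algebraic complex torus are of abelian type

Lane `lit-hodgefound`, row Q241 (= TRIBUNAL-B request V-B26, «`IsOfAbelianType (ComplexTorus.hodgeStructure Φ k)`
via `IsOfAbelianType.exteriorPower` transported along B53»).  André, *Pour une théorie inconditionnelle
des motifs*, §6.1 (p. 30): the Tannakian category `ℳ(𝒜b)` of Hodge structures of abelian type is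
«engendrée par les `h(A)`» for complex abelian varieties `A` — it contains every `H¹(A)` and is stable
under `⋀ᵏ`, so it contains `Hᵏ(A) = ⋀ᵏ H¹(A)` (van Geemen 1994, 3.3: «`Hᵖ(X, ℚ) = ∧ᵖ H¹(X, ℚ)`»).  On
the tree's FORMS carrier of a complex torus `E/Φ(ℤ^ι)` (`ComplexTorus.hodgeStructure Φ k` on
`Hᵏ(X, ℚ) = rationalForms Φ k`, `Geometry/Kaehler/ComplexTorusRationalHodgeStructure`) this reads, ALL
PROVED (no definition, no named fact; D-0026):

* `isOfAbelianType_complexTorus_hodgeStructure_of_one` — **transport along `⋀ᵏ H¹ ≅ Hᵏ`**: if the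
  weight-one structure `H¹(X, ℚ)_forms` is of abelian type then so is every `Hᵏ(X, ℚ)_forms`
  (`IsOfAbelianType.exteriorPower`, `.cast`, `.of_retract` of the tree along the isomorphism of Hodge
  structures `ComplexTorus.exteriorPowerHom` / `exteriorPowerInv` of
  `Geometry/Kaehler/ComplexTorusExteriorPowerHodgeStructure`, lane row A1-21 / record B53).
* `isOfAbelianType_complexTorus_hodgeStructure_one` — **`H¹(X, ℚ)_forms` is of abelian type when the
  torus is the analytification of a complex abelian variety `A`** (any Hodge symmetric Hodge model `M`
  of `A`): the generator `isOfAbelianType_hOne` (`H¹(A(ℂ); ℚ)` with `M.hodgeStructure hA hM 1` is of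
  abelian type) transported along the Betti–forms isomorphism `bettiFormsHom` / `formsBettiHom` of
  `ComplexTorusRationalHodgeStructureComparison` (lane row Q240).
* `isOfAbelianType_complexTorus_hodgeStructure` — **every `Hᵏ(X, ℚ)_forms`, `k ≥ 0`, of a complex
  torus analytifying a complex abelian variety is of abelian type** (a Hodge symmetric model exists,
  `exists_isReal_hodgeModel_holds`; `A` is smooth projective, `AbelianVariety.isSmoothProjective_holds`).
* `IsIsogeny.isOfAbelianType_hodgeStructure`, `IsIsogeny.isOfAbelianType_hodgeStructure'` (TRIBUNAL-B
  request V-B27) — **being of abelian type is an isogeny invariant** of the forms-carrier structures: an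
  isogeny `X → X'` (`ComplexTorus.IsIsogeny Φ Φ' A`) induces an isomorphism of `ℚ`-Hodge structures
  `Hᵏ(X', ℚ) ≅ Hᵏ(X, ℚ)` (`IsIsogeny.pullbackHom` / `pullbackInv` of
  `Geometry/Kaehler/ComplexTorusRationalHodgeStructurePullback`, lane row A1-21 FILE 2 / record B54), and
  `ℳ(𝒜b)` is stable under isomorphic copies (`IsOfAbelianType.of_retract`).

Nothing is claimed for a complex torus that is not the analytification of an abelian variety (its
`H¹` need not be polarisable, and structures of abelian type are polarisable,
`IsOfAbelianType.isPolarizable`).  Consumers obtain polarisability / semisimplicity of the forms-carrier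
structures of an algebraic torus from the tree's `IsOfAbelianType.isPolarizable`,
`IsOfAbelianType.exists_isCompl` (`Motives/HodgeStructureAbelianTypePolarizable`, not imported here).

## References

* [Andre1996Motifs] Y. André, *Pour une théorie inconditionnelle des motifs*, Publ. Math. IHÉS 83
  (1996), §6.1 (p. 30), Thm. 0.6.3 (p. 9).
* [vanGeemen1994HodgeAV] B. van Geemen, *An introduction to the Hodge conjecture for abelian
  varieties*, LNM 1594 (1994), 3.3 (PDF p. 3).
* [Moonen2017FamiliesMotives] B. Moonen, *Families of motives and the Mumford–Tate conjecture*
  (2017), §2.1, §3.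
* [Lange2023AbelianVarietiesComplex] H. Lange, *Abelian Varieties over the Complex Numbers* (2023),
  §1.1.3 Lemma 1.1.17 (a), §1.1.5 Thm. 1.1.21.
-/

noncomputable section

open Literature.AlgebraicTopology.SingularHomology Literature.NumberTheory.Transcendental
  Literature.Geometry.Kaehler
open Literature.AlgebraicGeometry.Motives (ComplexPoints IsSmoothProjective AbelianVariety HodgeStructure
  hodgeTensorFacts_holds HodgeTensorFacts)
open Literature.AlgebraicGeometry.Motives.HodgeStructure (isOfAbelianType_hOne Hom)

namespace Literature.AlgebraicGeometry.HodgeTheory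

variable {ι : Type} [Fintype ι] {E : Type} [NormedAddCommGroup E] [NormedSpace ℂ E]
  (Φ : (ι → ℝ) ≃L[ℝ] E)

/-- **Transport along `⋀ᵏ H¹(X, ℚ) ≅ Hᵏ(X, ℚ)`**: if the weight-one forms-carrier structure
`H¹(X, ℚ)_forms = ComplexTorus.hodgeStructure Φ 1` of a complex torus is of abelian type, then so is
`Hᵏ(X, ℚ)_forms = ComplexTorus.hodgeStructure Φ k` for every `k` — `⋀ᵏ` of a structure of abelian type is
of abelian type (`IsOfAbelianType.exteriorPower`; André §6.1: `ℳ(𝒜b)` is a Tannakian subcategory), so is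
its weight-cast (`.cast`), and `Hᵏ(X, ℚ)_forms` is a retract (indeed an isomorphic copy,
`ComplexTorus.exteriorPowerHom` / `exteriorPowerInv`, van Geemen 3.3 «`Hᵖ(X, ℚ) = ∧ᵖ H¹(X, ℚ)`») of
`⋀ᵏ H¹(X, ℚ)_forms` (`.of_retract`). [cite: Andre1996Motifs, §6.1 (p. 30)] [cite: vanGeemen1994HodgeAV, 3.3 (PDF p. 3)] -/
theorem isOfAbelianType_complexTorus_hodgeStructure_of_one
    (h : (ComplexTorus.hodgeStructure Φ 1).IsOfAbelianType) (k : ℕ) :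
    (ComplexTorus.hodgeStructure Φ k).IsOfAbelianType := by
  haveI : HodgeTensorFacts.{0, 0} := hodgeTensorFacts_holds
  exact ((h.exteriorPower k).cast (mul_one (k : ℤ))).of_retract (ComplexTorus.exteriorPowerInv Φ k)
    (ComplexTorus.exteriorPowerHom Φ k) fun v ↦ (ComplexTorus.exteriorPowerFormsEquiv Φ k).apply_symm_apply v

variable [DecidableEq ι] [FiniteDimensional ℂ E]

/-- **`H¹(X, ℚ)_forms` of a complex torus analytifying a complex abelian variety is of abelian type**:
for a complex abelian variety `A` (smooth projective, `hA`), a Hodge symmetric Hodge model `M` of `A`,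
and a complex torus `E/Φ(ℤ^ι)` which is the analytification `φ` of `A`, the forms-carrier structure
`ComplexTorus.hodgeStructure Φ 1` is of abelian type — it is isomorphic (`formsBettiHom` / `bettiFormsHom`,
lane row Q240; Lange 2023 Lemma 1.1.17 (a) / Thm. 1.1.21) to `H¹(A(ℂ); ℚ)` with `M.hodgeStructure hA hM 1`,
which is of abelian type (`isOfAbelianType_hOne`, André §6.1: each `h¹(A)` lies in `ℳ(𝒜b)`).
[cite: Andre1996Motifs, §6.1 (p. 30)] [cite: Lange2023AbelianVarietiesComplex, §1.1.3 Lemma 1.1.17 (a) and §1.1.5 Thm. 1.1.21] -/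
theorem isOfAbelianType_complexTorus_hodgeStructure_one (A : AbelianVariety ℂ)
    (hA : IsSmoothProjective A.dim A.X) (M : HodgeModel A.dim A.X) (hM : M.IsHodgeSymmetric)
    (φ : C(ComplexTorus Φ, ComplexPoints A.X)) (hφ : IsAnalytification E A.X A.dim φ) :
    (ComplexTorus.hodgeStructure Φ 1).IsOfAbelianType :=
  (isOfAbelianType_hOne A hA M hM).of_retract (formsBettiHom Φ φ hφ hA M hM)
    (bettiFormsHom Φ φ hφ hA M hM) fun v ↦ (bettiFormsEquiv Φ φ hφ).apply_symm_apply v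

/-- **Every `Hᵏ(X, ℚ)_forms` of a complex torus analytifying a complex abelian variety is of abelian
type** (`k ≥ 0`; André §6.1 / van Geemen 3.3: `Hᵏ(A) = ⋀ᵏ H¹(A) ∈ ℳ(𝒜b)`): `A` is smooth projective
(`AbelianVariety.isSmoothProjective_holds`), a Hodge symmetric Hodge model exists
(`exists_isReal_hodgeModel_holds`), degree one is `isOfAbelianType_complexTorus_hodgeStructure_one`, and
degree `k` follows by `isOfAbelianType_complexTorus_hodgeStructure_of_one`.
[cite: Andre1996Motifs, §6.1 (p. 30)] [cite: vanGeemen1994HodgeAV, 3.3 (PDF p. 3)] -/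
theorem isOfAbelianType_complexTorus_hodgeStructure (A : AbelianVariety ℂ)
    (φ : C(ComplexTorus Φ, ComplexPoints A.X)) (hφ : IsAnalytification E A.X A.dim φ) (k : ℕ) :
    (ComplexTorus.hodgeStructure Φ k).IsOfAbelianType := by
  have hA : IsSmoothProjective A.dim A.X := AbelianVariety.isSmoothProjective_holds
  obtain ⟨M, hM⟩ := exists_isReal_hodgeModel_holds.exists_isHodgeSymmetric hA
  exact isOfAbelianType_complexTorus_hodgeStructure_of_one Φ
    (isOfAbelianType_complexTorus_hodgeStructure_one Φ A hA M hM φ hφ) k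

end Literature.AlgebraicGeometry.HodgeTheory

/-! ### Isogeny invariance (TRIBUNAL-B V-B27) -/

namespace Literature.Geometry.Kaehler.ComplexTorus

open Literature.AlgebraicGeometry.Motives.HodgeStructure

variable {ι ι' : Type*} [Fintype ι] [Fintype ι'] [DecidableEq ι] [DecidableEq ι'] {E E' : Type*} [NormedAddCommGroup E]
  [NormedSpace ℂ E]
  [NormedAddCommGroup E'] [NormedSpace ℂ E'] (Φ : (ι → ℝ) ≃L[ℝ] E) (Φ' : (ι' → ℝ) ≃L[ℝ] E')

/-- **Abelian type descends along an isogeny**: if `f = mapMatrix Φ Φ' A : X → X'` is an isogeny and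
`Hᵏ(X', ℚ)_forms` is of abelian type, then so is `Hᵏ(X, ℚ)_forms` — `f^* : Hᵏ(X', ℚ) ≅ Hᵏ(X, ℚ)` is an
isomorphism of `ℚ`-Hodge structures (`IsIsogeny.pullbackHom` / `pullbackInv`, Lange 2023 §7.3.3
Exercise (1)(a)) and structures of abelian type are stable under isomorphic copies (`of_retract`,
André §6.1). [cite: Andre1996Motifs, §6.1 (p. 30)] [cite: Lange2023AbelianVarietiesComplex, §7.3.3 Exercise (1)(a)] -/
theorem IsIsogeny.isOfAbelianType_hodgeStructure {A : Matrix ι' ι ℤ} (h : IsIsogeny Φ Φ' A) (k : ℕ)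
    (hk : (hodgeStructure Φ' k).IsOfAbelianType) : (hodgeStructure Φ k).IsOfAbelianType :=
  hk.of_retract (h.pullbackInv Φ Φ' k) (h.pullbackHom Φ Φ' k) fun v ↦
    congrArg (fun g ↦ Hom.toLinearMap g v) (h.pullbackHom_comp_pullbackInv Φ Φ' k)

/-- **Abelian type ascends along an isogeny**: if `X → X'` is an isogeny and `Hᵏ(X, ℚ)_forms` is of
abelian type, then so is `Hᵏ(X', ℚ)_forms` (same isomorphism, read backwards).
[cite: Andre1996Motifs, §6.1 (p. 30)] [cite: Lange2023AbelianVarietiesComplex, §7.3.3 Exercise (1)(a)] -/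
theorem IsIsogeny.isOfAbelianType_hodgeStructure' {A : Matrix ι' ι ℤ} (h : IsIsogeny Φ Φ' A) (k : ℕ)
    (hk : (hodgeStructure Φ k).IsOfAbelianType) : (hodgeStructure Φ' k).IsOfAbelianType :=
  hk.of_retract (h.pullbackHom Φ Φ' k) (h.pullbackInv Φ Φ' k) fun v ↦
    congrArg (fun g ↦ Hom.toLinearMap g v) (h.pullbackInv_comp_pullbackHom Φ Φ' k)

end Literature.Geometry.Kaehler.ComplexTorus

end
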